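import Summits.QuantumAdvantage.AdviceFreeQNC0.RegisterPathSum
import Summits.QuantumAdvantage.AdviceFreeQNC0.BlockRigidity
import HarnessLib

/-!
# Cell qa-qnc0, `p = 3` — the register chain: BLOCK DECAY of a chain of site operators (prover qn-prover-3 g22;
bookkeeping for `twistBoundX3Local_of`, planner qa-qnc0-p1 g20 `exp20/Sketch20x.lean` §7)

A chain `chainFrom W f i L` (`RegisterPathSum.lean`) whose site weights all have norm `≤ 1`, and whose sites in a set of GOOD
positions are of sign-and-phase form `signW (ζ j) (ε j)` with cube-root phases, contracts in `ℓ²` by the block constant `ρ²`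
(`blockOpR_contracts`, `BlockLemma.lean`) once for every block of `2r+1` consecutive good sites starting at a TWISTED site
(`ζ j ≠ 1`); blocks are chosen greedily from the left:

* `cnt bs K i L` — the greedy number of disjoint blocks of length `K` with admissible starts `bs` inside `[i, i+L)`;
  **`card_starts_le`** — every admissible start with room lies in SOME way counted: `#{j ∈ [i,i+L) : bs j, j+K ≤ i+L} ≤ K·cnt`;
* `chainFrom_good_eq_chainOp` — over consecutive good sites the general chain IS the `siteOpR` chain (`chainOp`), hence a block of
  `2r+1` good sites is `blockOpR` (`chainFrom_block`);
* **`rnsq_chainFrom_le_pow`** — `rnsq (chainFrom W f i L) ≤ (ρ²)^{cnt} · rnsq f`.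

WHAT THIS IS NOT: no strategy here; crux 22907 untouched; separation NOT moved.
-/

noncomputable section

namespace Summit.QuantumAdvantage.AdviceFreeQNC0

open Finset

namespace BondTwist3

variable {r : ℕ}

/-! ## Greedy block counting -/

/-- Greedy count of disjoint blocks of length `K` inside `[i, i+L)`: take a block at `i` if `i` is an admissible start and
there is room, else move on. -/
def cnt (bs : ℕ → Bool) (K : ℕ) : ℕ → ℕ → ℕ
  | _, 0 => 0
  | i, L + 1 =>
    if bs i = true ∧ K ≤ L + 1 ∧ 0 < K then 1 + cnt bs K (i + K) (L + 1 - K) else cnt bs K (i + 1) L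
termination_by _ L => L
decreasing_by all_goals omega

/-- Unfolding at a block start with room. -/
theorem cnt_start {bs : ℕ → Bool} {K i L : ℕ} (h : bs i = true) (hK : K ≤ L + 1) (hK0 : 0 < K) :
    cnt bs K i (L + 1) = 1 + cnt bs K (i + K) (L + 1 - K) := by
  rw [cnt]; rw [if_pos ⟨h, hK, hK0⟩]

/-- Unfolding elsewhere. -/
theorem cnt_skip {bs : ℕ → Bool} {K i L : ℕ} (h : ¬ (bs i = true ∧ K ≤ L + 1 ∧ 0 < K)) :
    cnt bs K i (L + 1) = cnt bs K (i + 1) L := by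
  rw [cnt]; rw [if_neg h]

/-- **Counting**: the admissible starts with room inside `[i, i+L)` number at most `K · cnt`. -/
theorem card_starts_le (bs : ℕ → Bool) {K : ℕ} (hK0 : 0 < K) :
    ∀ L i : ℕ, ((Ico i (i + L)).filter fun j => bs j = true ∧ j + K ≤ i + L).card ≤ K * cnt bs K i L := by
  intro L
  induction L using Nat.strong_induction_on with
  | _ L ih =>
    intro i
    cases L with
    | zero =>
      simp
    | succ L =>
      by_cases h : bs i = true ∧ K ≤ L + 1 ∧ 0 < K
      · rw [cnt_start h.1 h.2.1 hK0]
        have hrec := ih (L + 1 - K) (by omega) (i + K)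
        -- split `[i, i+L+1)` at `i + K`
        have hsub : ((Ico i (i + (L + 1))).filter fun j => bs j = true ∧ j + K ≤ i + (L + 1)) ⊆
            Ico i (i + K) ∪ ((Ico (i + K) (i + K + (L + 1 - K))).filter fun j => bs j = true ∧ j + K ≤ i + K + (L + 1 - K)) := by
          intro j hj
          rw [mem_filter, mem_Ico] at hj
          rw [mem_union, mem_Ico, mem_filter, mem_Ico]
          by_cases hjK : j < i + K
          · exact Or.inl ⟨hj.1.1, hjK⟩
          · exact Or.inr ⟨⟨by omega, by omega⟩, hj.2.1, by omega⟩
        calc ((Ico i (i + (L + 1))).filter fun j => bs j = true ∧ j + K ≤ i + (L + 1)).card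
            ≤ (Ico i (i + K) ∪ ((Ico (i + K) (i + K + (L + 1 - K))).filter
                fun j => bs j = true ∧ j + K ≤ i + K + (L + 1 - K))).card := card_le_card hsub
          _ ≤ (Ico i (i + K)).card + ((Ico (i + K) (i + K + (L + 1 - K))).filter
                fun j => bs j = true ∧ j + K ≤ i + K + (L + 1 - K)).card := card_union_le _ _
          _ ≤ K + K * cnt bs K (i + K) (L + 1 - K) := by
              rw [Nat.card_Ico, show i + K - i = K by omega]; exact Nat.add_le_add_left hrec K
          _ = K * (1 + cnt bs K (i + K) (L + 1 - K)) := by ring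
      · rw [cnt_skip h]
        have hrec := ih L (by omega) (i + 1)
        by_cases hb : bs i = true
        · -- a start without room: then no start in the range has room
          have hnoroom : ¬ K ≤ L + 1 := fun hle => h ⟨hb, hle, hK0⟩
          have hempty : ((Ico i (i + (L + 1))).filter fun j => bs j = true ∧ j + K ≤ i + (L + 1)) = ∅ := by
            refine filter_eq_empty_iff.2 fun j hj hj' => ?_
            rw [mem_Ico] at hj
            omega
          rw [hempty, card_empty]
          exact Nat.zero_le _
        · have hsub : ((Ico i (i + (L + 1))).filter fun j => bs j = true ∧ j + K ≤ i + (L + 1)) ⊆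
              ((Ico (i + 1) (i + 1 + L)).filter fun j => bs j = true ∧ j + K ≤ i + 1 + L) := by
            intro j hj
            rw [mem_filter, mem_Ico] at hj ⊢
            have hji : j ≠ i := fun e => hb (e ▸ hj.2.1)
            exact ⟨⟨by omega, by omega⟩, hj.2.1, by omega⟩
          exact (card_le_card hsub).trans hrec

/-! ## Good sites: the general chain is the `siteOpR` chain -/

/-- Over `K` consecutive sites of sign-and-phase form the general chain is the `siteOpR` chain `chainOp`. -/
theorem chainFrom_good_eq_chainOp (W : ℕ → RegState r → Bool → ℂ) (ζ : ℕ → ℂ) (ε : ℕ → RegState r → Bool → Bool)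
    (f : RegState r → ℂ) :
    ∀ (K j L : ℕ), (∀ m, m < K → W (j + m) = signW (ζ (j + m)) (ε (j + m))) →
      chainFrom W f j (K + L) = chainOp (List.ofFn fun m : Fin K => (ζ (j + m.val), ε (j + m.val))) (chainFrom W f (j + K) L)
  | 0, j, L, _ => by
    rw [List.ofFn_zero, chainOp_nil, Nat.zero_add, Nat.add_zero]
  | K + 1, j, L, hgood => by
    rw [show K + 1 + L = (K + L) + 1 by omega, chainFrom_succ, List.ofFn_succ, chainOp_cons]
    have h0 : W j = signW (ζ j) (ε j) := by simpa using hgood 0 (by omega)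
    have ih := chainFrom_good_eq_chainOp W ζ ε f K (j + 1) L (fun m hm => by
      rw [show j + 1 + m = j + (m + 1) by omega]; exact hgood (m + 1) (by omega))
    rw [h0, genOp_sign, ih]
    have hfun : (fun m : Fin K => (ζ (j + 1 + m.val), ε (j + 1 + m.val))) =
        fun m : Fin K => (ζ (j + (m.val + 1)), ε (j + (m.val + 1))) := by
      funext m; rw [show j + 1 + m.val = j + (m.val + 1) by omega]
    rw [hfun]
    simp only [Fin.val_zero, add_zero, Fin.val_succ, show j + 1 + K = j + (K + 1) by omega]

/-- A block of `2r+1` good sites is the block operator `blockOpR`. -/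
theorem chainFrom_block (W : ℕ → RegState r → Bool → ℂ) (ζ : ℕ → ℂ) (ε : ℕ → RegState r → Bool → Bool)
    (f : RegState r → ℂ) (j L : ℕ) (hgood : ∀ m, m < 2 * r + 1 → W (j + m) = signW (ζ (j + m)) (ε (j + m))) :
    chainFrom W f j (2 * r + 1 + L) =
      blockOpR (ζ j) (fun m : Fin (2 * r) => ζ (j + 1 + m.val)) (fun m : Fin (2 * r + 1) => ε (j + m.val))
        (chainFrom W f (j + (2 * r + 1)) L) := by
  rw [chainFrom_good_eq_chainOp W ζ ε f (2 * r + 1) j L hgood, blockOpR_eq_chainOp, List.ofFn_succ]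
  have hfun : (fun m : Fin (2 * r) => (ζ (j + 1 + m.val), ε (j + (m.val + 1)))) =
      fun m : Fin (2 * r) => (ζ (j + (m.val + 1)), ε (j + (m.val + 1))) := by
    funext m; rw [show j + 1 + m.val = j + (m.val + 1) by omega]
  simp only [Fin.val_zero, add_zero, Fin.val_succ, hfun]

/-! ## The block decay -/

/-- **BLOCK DECAY of a chain.**  Site weights of norm `≤ 1` everywhere; at the GOOD sites (`good j`) the weight is
`signW (ζ j) (ε j)`; all phases are cube roots of unity; an admissible block start `bs j` is a twisted good site (`ζ j ≠ 1`) followed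
by `2r` good sites.  Then the chain over `[i, i+L)` contracts by `(ρ²)^{cnt bs (2r+1) i L}`, `ρ` the block constant of
`blockOpR_contracts`. -/
theorem rnsq_chainFrom_le_pow {ρ : ℝ}
    (hblock : ∀ (ζ₀ : ℂ), ζ₀ ^ 3 = 1 → ζ₀ ≠ 1 → ∀ (ω : Fin (2 * r) → ℂ), (∀ j, ω j ^ 3 = 1) →
      ∀ (ε' : Fin (2 * r + 1) → RegState r → Bool → Bool) (g : RegState r → ℂ),
        rnsq (blockOpR ζ₀ ω ε' g) ≤ ρ ^ 2 * rnsq g)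
    (W : ℕ → RegState r → Bool → ℂ) (ζ : ℕ → ℂ) (ε : ℕ → RegState r → Bool → Bool) (good bs : ℕ → Bool)
    (hW : ∀ j σ b, ‖W j σ b‖ ≤ 1) (hζ : ∀ j, ζ j ^ 3 = 1)
    (hgood : ∀ j, good j = true → W j = signW (ζ j) (ε j))
    (hbs : ∀ j, bs j = true → ζ j ≠ 1 ∧ ∀ m, m < 2 * r + 1 → good (j + m) = true)
    (f : RegState r → ℂ) :
    ∀ L i : ℕ, rnsq (chainFrom W f i L) ≤ (ρ ^ 2) ^ (cnt bs (2 * r + 1) i L) * rnsq f := by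
  intro L
  induction L using Nat.strong_induction_on with
  | _ L ih =>
    intro i
    cases L with
    | zero => simp [cnt]
    | succ L =>
      by_cases h : bs i = true ∧ 2 * r + 1 ≤ L + 1 ∧ 0 < 2 * r + 1
      · rw [cnt_start h.1 h.2.1 h.2.2]
        obtain ⟨hζi, hgoods⟩ := hbs i h.1
        have hsplit : L + 1 = 2 * r + 1 + (L + 1 - (2 * r + 1)) := by omega
        have hrec := ih (L + 1 - (2 * r + 1)) (by omega) (i + (2 * r + 1))
        have key := chainFrom_block W ζ ε f i (L + 1 - (2 * r + 1)) (fun m hm => hgood (i + m) (hgoods m hm))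
        rw [← hsplit] at key
        rw [key]
        refine (hblock (ζ i) (hζ i) hζi _ (fun m => hζ _) _ _).trans ?_
        rw [pow_add, pow_one, mul_assoc]
        exact mul_le_mul_of_nonneg_left hrec (sq_nonneg ρ)
      · rw [cnt_skip h, chainFrom_succ]
        exact (rnsq_genOp_le (W i) (hW i) _).trans (ih L (by omega) (i + 1))

end BondTwist3

end Summit.QuantumAdvantage.AdviceFreeQNC0

end
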